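import Mathlib
import HarnessLib
import Summits.ValiantsHypothesis.ValiantsHypothesis.Theses.MonotoneRestoration
import Literature.Computability.AlgebraicComplexity.PatternExpressions
import Literature.Computability.AlgebraicComplexity.SymmetricCircuitPairing
import Literature.Computability.AlgebraicComplexity.SymmetricCircuitScaledInputs
import Literature.Computability.AlgebraicComplexity.SymmetricCircuitPullback
import Literature.Computability.AlgebraicComplexity.SymmetricCircuitFibreFold
import Literature.Computability.AlgebraicComplexity.SymmetricCircuitConstOutputs
import Literature.Computability.AlgebraicComplexity.SymmetricCircuitHadamard
import Literature.Computability.AlgebraicComplexity.SymmetricCircuitLinCombOutputsSymmetry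
import Literature.Computability.AlgebraicComplexity.SymmetricCircuitFold
import Summits.ValiantsHypothesis.ValiantsHypothesis.Theorems.MonotoneRestorationMonotoneRestorationQPZetaHomogeneous

/-! # Route MonotoneRestoration — crux `MonotoneRestorationQP`, line Sketch v10: THEOREM ζ-P
(stmt-ValiantsHypothesis-15886, lead c5)

**Labelled pattern expressions (the bipartite graph algebra) are square-symmetric circuits** —
the engine behind "linear combinations of homomorphism polynomials of bounded-treewidth patterns
have polynomial-size symmetric circuits" (Dawar–Pago–Seppelt 2025, §5), in the compositional form
the size calculus THEOREM ζ affords: a `k`-row/`l`-column labelled quantity is an OUTPUT FAMILY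
indexed by the label assignments `(Fin k → Fin n) × (Fin l → Fin n)` (diagonal `Sym(Fin n)` action),
and each operation of the algebra is one landed gadget — edge insertion = pull-back (Z9) of the
(scaled, Z2) input family; constants = invariant constant families (Z8); sum / product = pairing +
linear combination (Z5) / Hadamard (Z4); summing out a label = fibre sum (Z10) along the projection
forgetting that label, pulled back (Z9); closing = orbit sum (Z3).

* `zeta_symmetric_patternExpr` — an expression `e` with `k + l` labels and `|e|` operations is
  computed, at outputs indexed by all label assignments, by a square-symmetric circuit on at most
  `|e| · (2n² + 4 n^{k+l} + 5)` gates (`1 ≤ n`);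
* `zeta_symmetric_patternExpr_close` — its closed polynomial `Σ_{ρ,γ} value e ρ γ` on one more gate;
* `qpSymmetric_patternExpr` — COROLLARY AT THE CRUX'S SCALE (registered): families presented as
  closed pattern expressions with `n^{k_n + l_n}` and `|e_n|` quasi-polynomial (i.e. polylog many
  labels, quasi-polynomially many operations) have square-symmetric circuits of quasi-polynomial
  size. With `Literature.…PatternExpressions` (`homPoly`, p164274) this types census T9/D8(ii):
  the bounded-(polylog-)width homomorphism regime of L1 restores, unconditionally.
-/

noncomputable section

-- `Summit.ValiantsHypothesis.ValiantsHypothesis.…` is the tree's mandated namespace (Sub = Summit).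
set_option linter.dupNamespace false

namespace Summit.ValiantsHypothesis.ValiantsHypothesis.Theorems

open Literature.Computability.AlgebraicComplexity

/-! ### Bookkeeping on label assignments -/

/-- The number of label assignments is `n^{k+l}`. [folklore] -/
theorem zeta_card_assignments (k l n : ℕ) :
    Fintype.card ((Fin k → Fin n) × (Fin l → Fin n)) = n ^ (k + l) := by
  simp [Fintype.card_prod, Fintype.card_fin, pow_add]

/-- Restricting the row assignment away from one label has at most `n^{k+l}` values (`1 ≤ n`).
[folklore] -/
theorem zeta_card_rowRestrict_le (k l n : ℕ) [NeZero n] (a : Fin k) :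
    Fintype.card (({b : Fin k // b ≠ a} → Fin n) × (Fin l → Fin n)) ≤ n ^ (k + l) := by
  have hn : 1 ≤ n := Nat.one_le_iff_ne_zero.mpr (NeZero.ne n)
  simp only [Fintype.card_prod, Fintype.card_fun, Fintype.card_fin, pow_add]
  exact Nat.mul_le_mul_right _
    (Nat.pow_le_pow_right hn ((Fintype.card_subtype_le _).trans (by simp)))

/-- Restricting the column assignment away from one label has at most `n^{k+l}` values (`1 ≤ n`).
[folklore] -/
theorem zeta_card_colRestrict_le (k l n : ℕ) [NeZero n] (b : Fin l) :
    Fintype.card ((Fin k → Fin n) × ({b' : Fin l // b' ≠ b} → Fin n)) ≤ n ^ (k + l) := by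
  have hn : 1 ≤ n := Nat.one_le_iff_ne_zero.mpr (NeZero.ne n)
  simp only [Fintype.card_prod, Fintype.card_fun, Fintype.card_fin, pow_add]
  exact Nat.mul_le_mul_left _
    (Nat.pow_le_pow_right hn ((Fintype.card_subtype_le _).trans (by simp)))

/-- The fibre of the projection forgetting row label `a` through `(ρ, γ)` is the set of
`(ρ[a := v], γ)`. [folklore] -/
theorem zeta_fibre_rowRestrict {k l n : ℕ} (a : Fin k) (ρ : Fin k → Fin n) (γ : Fin l → Fin n) :
    (Finset.univ.filter fun y : (Fin k → Fin n) × (Fin l → Fin n) =>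
        ((fun b : {b : Fin k // b ≠ a} => y.1 b.1), y.2) =
          ((fun b : {b : Fin k // b ≠ a} => ρ b.1), γ)) =
      Finset.univ.image fun v : Fin n => (Function.update ρ a v, γ) := by
  ext ⟨ρ', γ'⟩
  simp only [Finset.mem_filter, Finset.mem_univ, true_and, Finset.mem_image, Prod.mk.injEq]
  constructor
  · rintro ⟨h1, rfl⟩
    refine ⟨ρ' a, ?_, rfl⟩
    funext b
    by_cases hb : b = a
    · subst hb; simp
    · rw [Function.update_of_ne hb]
      exact (congrFun h1 ⟨b, hb⟩).symm
  · rintro ⟨v, rfl, rfl⟩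
    refine ⟨?_, rfl⟩
    funext b
    exact Function.update_of_ne b.2 v ρ

/-- The fibre of the projection forgetting column label `b` through `(ρ, γ)` is the set of
`(ρ, γ[b := v])`. [folklore] -/
theorem zeta_fibre_colRestrict {k l n : ℕ} (b : Fin l) (ρ : Fin k → Fin n) (γ : Fin l → Fin n) :
    (Finset.univ.filter fun y : (Fin k → Fin n) × (Fin l → Fin n) =>
        (y.1, (fun b' : {b' : Fin l // b' ≠ b} => y.2 b'.1)) =
          (ρ, (fun b' : {b' : Fin l // b' ≠ b} => γ b'.1))) =
      Finset.univ.image fun v : Fin n => (ρ, Function.update γ b v) := by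
  ext ⟨ρ', γ'⟩
  simp only [Finset.mem_filter, Finset.mem_univ, true_and, Finset.mem_image, Prod.mk.injEq]
  constructor
  · rintro ⟨rfl, h2⟩
    refine ⟨γ' b, rfl, ?_⟩
    funext b'
    by_cases hb : b' = b
    · subst hb; simp
    · rw [Function.update_of_ne hb]
      exact (congrFun h2 ⟨b', hb⟩).symm
  · rintro ⟨v, rfl, rfl⟩
    refine ⟨rfl, ?_⟩
    funext b'
    exact Function.update_of_ne b'.2 v γ

/-! ### THEOREM ζ-P -/

/-- **THEOREM ζ-P — LABELLED PATTERN EXPRESSIONS ARE SQUARE-SYMMETRIC CIRCUITS.** For `1 ≤ n`,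
every labelled pattern expression `e` with `k` row labels and `l` column labels
(`Literature.…PatternExpr`) is computed — as the output family `(ρ, γ) ↦ value n e ρ γ` indexed by
all label assignments, under the diagonal action of `Sym(Fin n)` — by a square-symmetric circuit on
at most `|e| · (2n² + 4 n^{k+l} + 5)` gates. Induction on `e`; each operation is one gadget of the
size calculus (module docstring). [cite: DawarPagoSeppelt2025, §5 (proof of Thm 5.3)] -/
theorem zeta_symmetric_patternExpr {R : Type} [CommSemiring R] {k l n : ℕ} [NeZero n]
    (e : PatternExpr R k l) :
    ∃ (G : Type) (_ : Fintype G)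
      (C : LabelledArithCircuit R (Fin n × Fin n) ((Fin k → Fin n) × (Fin l → Fin n)) G),
      C.IsSymmetric (Equiv.Perm (Fin n)) ∧
      (∀ ρ γ, C.eval (C.output (ρ, γ)) = e.value n ρ γ) ∧
      Fintype.card G ≤ e.length * (2 * (n * n) + 4 * n ^ (k + l) + 5) := by
  have hN := zeta_card_assignments k l n
  induction e with
  | edge a b =>
    obtain ⟨G₁, i₁, C₁, h₁, hev₁, hc₁⟩ := LabelledArithCircuit.exists_scaledInputs
      (K := R) (X := Fin n × Fin n) (Equiv.Perm (Fin n)) 1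
    obtain ⟨G, inst, C, hC, hev, hc⟩ := h₁.exists_pullback
      (fun y : (Fin k → Fin n) × (Fin l → Fin n) => (y.1 a, y.2 b)) (fun σ y => rfl)
    refine ⟨G, inst, C, hC, fun ρ γ => ?_, ?_⟩
    · rw [hev, hev₁, map_one, one_mul]; rfl
    · have hX : Fintype.card (Fin n × Fin n) = n * n := by simp
      rw [hN] at hc; rw [hX] at hc₁
      simp only [PatternExpr.length, one_mul]
      omega
  | const c =>
    obtain ⟨G, inst, C, hC, hev, hc⟩ := LabelledArithCircuit.exists_constOutputs (K := R)
      (Fin n × Fin n) (Γ := Equiv.Perm (Fin n))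
      (fun _ : (Fin k → Fin n) × (Fin l → Fin n) => c) (fun _ _ => rfl)
    refine ⟨G, inst, C, hC, fun ρ γ => hev (ρ, γ), ?_⟩
    rw [hN] at hc
    simp only [PatternExpr.length, one_mul]
    omega
  | add e₁ e₂ ih₁ ih₂ =>
    obtain ⟨G₁, i₁, C₁, h₁, hev₁, hc₁⟩ := ih₁
    obtain ⟨G₂, i₂, C₂, h₂, hev₂, hc₂⟩ := ih₂
    obtain ⟨G₀, i₀, C₀, h₀, hinl, hinr, hc₀⟩ := h₁.exists_pairing h₂
    obtain ⟨G, inst, C, hC, hev, hc⟩ := h₀.exists_linCombOutputs C₀ 1 1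
    refine ⟨G, inst, C, hC, fun ρ γ => ?_, ?_⟩
    · rw [hev, hinl, hinr, hev₁, hev₂, map_one, one_mul, one_mul]; rfl
    · rw [hN] at hc
      simp only [PatternExpr.length]
      nlinarith
  | mul e₁ e₂ ih₁ ih₂ =>
    obtain ⟨G₁, i₁, C₁, h₁, hev₁, hc₁⟩ := ih₁
    obtain ⟨G₂, i₂, C₂, h₂, hev₂, hc₂⟩ := ih₂
    obtain ⟨G₀, i₀, C₀, h₀, hinl, hinr, hc₀⟩ := h₁.exists_pairing h₂
    obtain ⟨G, inst, C, hC, hev, hc⟩ := h₀.exists_hadamard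
    refine ⟨G, inst, C, hC, fun ρ γ => ?_, ?_⟩
    · rw [hev, hinl, hinr, hev₁, hev₂]; rfl
    · rw [hN] at hc
      simp only [PatternExpr.length]
      nlinarith
  | sumRow a e ih =>
    obtain ⟨G₁, i₁, C₁, h₁, hev₁, hc₁⟩ := ih
    -- forget row label `a`: fibre sum along the projection, then pull back
    let p : (Fin k → Fin n) × (Fin l → Fin n) → ({b : Fin k // b ≠ a} → Fin n) × (Fin l → Fin n) :=
      fun y => ((fun b => y.1 b.1), y.2)
    have hp : ∀ (σ : Equiv.Perm (Fin n)) (y : (Fin k → Fin n) × (Fin l → Fin n)),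
        p (σ • y) = σ • p y := fun σ y => rfl
    have hsurj : Function.Surjective p := by
      rintro ⟨ρ₀, γ⟩
      refine ⟨((fun b => if h : b = a then 0 else ρ₀ ⟨b, h⟩), γ), ?_⟩
      simp only [p, Prod.mk.injEq, and_true]
      funext b
      simp [dif_neg b.2]
    obtain ⟨G₂, i₂, C₂, h₂, hev₂, hc₂⟩ := h₁.exists_fibreSum p hp hsurj
    obtain ⟨G, inst, C, hC, hev, hc⟩ := h₂.exists_pullback p hp
    refine ⟨G, inst, C, hC, fun ρ γ => ?_, ?_⟩
    · rw [hev, hev₂, PatternExpr.value_sumRow]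
      rw [show (Finset.univ.filter fun y => p y = p (ρ, γ)) =
          Finset.univ.image fun v : Fin n => (Function.update ρ a v, γ) from
        zeta_fibre_rowRestrict a ρ γ]
      rw [Finset.sum_image fun v _ w _ hvw => by
        have := congrFun (Prod.ext_iff.1 hvw).1 a
        simpa using this]
      exact Finset.sum_congr rfl fun v _ => hev₁ _ _
    · have hc₂' := zeta_card_rowRestrict_le k l n a
      rw [hN] at hc
      simp only [PatternExpr.length]
      nlinarith
  | sumCol b e ih =>
    obtain ⟨G₁, i₁, C₁, h₁, hev₁, hc₁⟩ := ih
    let p : (Fin k → Fin n) × (Fin l → Fin n) → (Fin k → Fin n) × ({b' : Fin l // b' ≠ b} → Fin n) :=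
      fun y => (y.1, (fun b' => y.2 b'.1))
    have hp : ∀ (σ : Equiv.Perm (Fin n)) (y : (Fin k → Fin n) × (Fin l → Fin n)),
        p (σ • y) = σ • p y := fun σ y => rfl
    have hsurj : Function.Surjective p := by
      rintro ⟨ρ, γ₀⟩
      refine ⟨(ρ, (fun b' => if h : b' = b then 0 else γ₀ ⟨b', h⟩)), ?_⟩
      simp only [p, Prod.mk.injEq, true_and]
      funext b'
      simp [dif_neg b'.2]
    obtain ⟨G₂, i₂, C₂, h₂, hev₂, hc₂⟩ := h₁.exists_fibreSum p hp hsurj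
    obtain ⟨G, inst, C, hC, hev, hc⟩ := h₂.exists_pullback p hp
    refine ⟨G, inst, C, hC, fun ρ γ => ?_, ?_⟩
    · rw [hev, hev₂, PatternExpr.value_sumCol]
      rw [show (Finset.univ.filter fun y => p y = p (ρ, γ)) =
          Finset.univ.image fun v : Fin n => (ρ, Function.update γ b v) from
        zeta_fibre_colRestrict b ρ γ]
      rw [Finset.sum_image fun v _ w _ hvw => by
        have := congrFun (Prod.ext_iff.1 hvw).2 b
        simpa using this]
      exact Finset.sum_congr rfl fun v _ => hev₁ _ _
    · have hc₂' := zeta_card_colRestrict_le k l n b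
      rw [hN] at hc
      simp only [PatternExpr.length]
      nlinarith

/-- **ζ-P, closed form.** For `1 ≤ n`, the closed polynomial `Σ_{ρ,γ} value n e ρ γ` of a labelled
pattern expression is computed by a square-symmetric single-output circuit on at most
`|e| · (2n² + 4 n^{k+l} + 5) + 1` gates (orbit sum Z3 of the family). [cite: DawarPagoSeppelt2025, §5] -/
theorem zeta_symmetric_patternExpr_close {R : Type} [CommSemiring R] {k l n : ℕ} [NeZero n]
    [MulAction (Equiv.Perm (Fin n)) Unit] (e : PatternExpr R k l) :
    ∃ (G : Type) (_ : Fintype G) (C : LabelledArithCircuit R (Fin n × Fin n) Unit G),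
      C.IsSymmetric (Equiv.Perm (Fin n)) ∧ C.eval (C.output ()) = e.close n ∧
      Fintype.card G ≤ e.length * (2 * (n * n) + 4 * n ^ (k + l) + 5) + 1 := by
  obtain ⟨G₁, i₁, C₁, h₁, hev₁, hc₁⟩ := zeta_symmetric_patternExpr (n := n) e
  obtain ⟨G, inst, C, hC, hev, hc⟩ := h₁.exists_sumOutputs
  refine ⟨G, inst, C, hC, ?_, hc.trans (Nat.add_le_add_right hc₁ 1)⟩
  rw [hev, PatternExpr.close, ← Finset.univ_product_univ, Finset.sum_product]
  exact Finset.sum_congr rfl fun ρ _ => Finset.sum_congr rfl fun γ _ => hev₁ ρ γ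

/-! ### The corollary at the crux's scale -/

/-- A constant polynomial is computed by a one-gate circuit, symmetric for every action.
[folklore] -/
theorem zeta_symmetric_constant {R X Γ : Type} [CommSemiring R] [Group Γ] [MulAction Γ X]
    [MulAction Γ Unit] (c : R) :
    ∃ (G : Type) (_ : Fintype G) (C : LabelledArithCircuit R X Unit G),
      C.IsSymmetric Γ ∧ C.eval (C.output ()) = MvPolynomial.C c ∧ Fintype.card G ≤ 1 := by
  let C : LabelledArithCircuit R X Unit Unit :=
    { children := fun _ => ∅, label := fun _ => .const c, output := fun _ => (),
      wf := ⟨fun u => Acc.intro u fun v hv => absurd hv (Finset.notMem_empty v)⟩,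
      isInput_iff := fun _ => by simp,
      eq_of_label_eq := fun u v _ _ => Subsingleton.elim u v,
      output_injective := fun u v _ => Subsingleton.elim u v }
  refine ⟨Unit, inferInstance, C, fun γ => ⟨1, ⟨fun _ => by simp [C], fun _ => rfl, fun _ => rfl⟩⟩,
    C.eval_of_label_const rfl, by simp⟩

/-- **COROLLARY ζ-P (crux scale) — THE LABELLED-PATTERN REGIME RESTORES.** If a family
`f_n ∈ ℂ[x_ij : i, j < n]` is, for every `n ≥ 1`, the closed polynomial of a labelled pattern
expression `e_n` with `k_n` row and `l_n` column labels such that `n^{k_n + l_n} ≤ 2^{(log₂ n + c)^c}`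
(polylogarithmically many labels) and `|e_n| ≤ 2^{(log₂ n + c)^c}`, then `f_n` has square-symmetric
circuits of quasi-polynomial size. In particular linear combinations of quasi-polynomially many
homomorphism polynomials of patterns of polylogarithmic width (given as expressions) satisfy the
conclusion of `MonotoneRestorationQP` (census T9 / D8(ii); DPS25 Thm 5.3, DPS26 Cor 3.3's easy
direction, at the quasi-polynomial scale). [cite: DawarPagoSeppelt2025, §5] -/
theorem qpSymmetric_patternExpr :
    ∀ (f : (n : ℕ) → MvPolynomial (Fin n × Fin n) ℂ),
      (∃ c : ℕ, ∀ n : ℕ, 1 ≤ n → ∃ (k l : ℕ) (e : PatternExpr ℂ k l),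
        n ^ (k + l) ≤ 2 ^ ((Nat.log 2 n + c) ^ c) ∧ e.length ≤ 2 ^ ((Nat.log 2 n + c) ^ c) ∧
        e.close n = f n) →
      ∃ c : ℕ, ∀ n : ℕ, ∃ (G : Type) (_ : Fintype G)
        (C : LabelledArithCircuit ℂ (Fin n × Fin n) Unit G),
        C.IsSymmetric (Equiv.Perm (Fin n)) ∧ C.eval (C.output ()) = f n ∧
          Fintype.card G ≤ 2 ^ ((Nat.log 2 n + c) ^ c) := by
  intro f hf
  obtain ⟨c, hc⟩ := hf
  obtain ⟨c₃, hc₃⟩ := zeta_poly_mul_qp_le 12 2 c 2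
  refine ⟨c₃, fun n => ?_⟩
  rcases Nat.eq_zero_or_pos n with rfl | hn
  · -- `n = 0`: no variables, `f 0` is a constant
    obtain ⟨G, inst, C, hC, hev, hcard⟩ := zeta_symmetric_constant (X := Fin 0 × Fin 0)
      (Γ := Equiv.Perm (Fin 0)) (MvPolynomial.coeff 0 (f 0))
    refine ⟨G, inst, C, hC, ?_, hcard.trans Nat.one_le_two_pow⟩
    rw [hev]
    exact (MvPolynomial.eq_C_of_isEmpty (f 0)).symm
  · haveI : NeZero n := ⟨by omega⟩
    obtain ⟨k, l, e, hkl, hlen, hclose⟩ := hc n hn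
    obtain ⟨G, inst, C, hC, hev, hcard⟩ := zeta_symmetric_patternExpr_close (n := n) e
    refine ⟨G, inst, C, hC, by rw [hev, hclose], hcard.trans (le_trans ?_ (hc₃ n))⟩
    set Q := 2 ^ ((Nat.log 2 n + c) ^ c) with hQ
    have hQ1 : 1 ≤ Q := Nat.one_le_two_pow
    have h2 : 2 ^ (2 * (Nat.log 2 n + c) ^ c) = Q * Q := by rw [two_mul, pow_add]
    rw [h2]
    have hP : 4 ≤ (n + 2) ^ 2 := by nlinarith
    have hnn : n * n ≤ (n + 2) ^ 2 := by nlinarith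
    set P := (n + 2) ^ 2 with hPdef
    have hQQ : Q ≤ Q * Q := by nlinarith
    calc e.length * (2 * (n * n) + 4 * n ^ (k + l) + 5) + 1
        ≤ Q * (2 * P + 4 * Q + 5) + 1 := by
          have := Nat.mul_le_mul hlen
            (show 2 * (n * n) + 4 * n ^ (k + l) + 5 ≤ 2 * P + 4 * Q + 5 by omega)
          omega
      _ = 2 * P * Q + 4 * (Q * Q) + 5 * Q + 1 := by ring
      _ ≤ 2 * P * (Q * Q) + P * (Q * Q) + 5 * P * (Q * Q) + P * (Q * Q) := by
          have e1 := Nat.mul_le_mul_left (2 * P) hQQ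
          have e2 : 4 * (Q * Q) ≤ P * (Q * Q) := Nat.mul_le_mul_right _ hP
          have e3 : 5 * Q ≤ 5 * P * (Q * Q) := by nlinarith
          have e4 : 1 ≤ P * (Q * Q) := by nlinarith
          omega
      _ = 9 * P * (Q * Q) := by ring
      _ ≤ 12 * P * (Q * Q) := by nlinarith

end Summit.ValiantsHypothesis.ValiantsHypothesis.Theorems

end
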